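import Literature.NumberTheory.LFunctions.GeneralizedEulerConstantsHarmonic
import HarnessLib

/-!
# The Möbius–logarithm sum `Σ_{d∣q} μ(d)(q/d) log(q/d)`, and `ψ(a/q)`, `γ(a,q)` through `L(1,χ)`

Topic `Literature/NumberTheory/LFunctions`. Proofs only (no definitions, no named facts); sequel of
`GeneralizedEulerConstantsHarmonic.lean` (the coprime digamma sum in closed form) and of P1 g56's
`DigammaRationalCharacterSums.lean` (Murty–Rath, Theorem 22.7 and `S_q` by Möbius).

* **The arithmetic identity** of Diamond–Ford 2008, §1 (display before Proposition 1):
  «`−Σ_{d∣P} μ(d) log d / d = Σ_{ab∣P} Λ(a)μ(b)/(ab) = δ_P Σ_{p∈P} log p/(p−1)`» — here for every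
  `q ≥ 1` in the forms `Σ_{d∣q} μ(d)(q/d) log(q/d) = φ(q)(log q + Σ_{p∣q} log p/(p−1))`
  (`sum_moebius_mul_div_mul_log_div_eq`) and `Σ_{d∣q} μ(d)(q/d) log d = −φ(q) Σ_{p∣q} log p/(p−1)`
  (`sum_moebius_mul_div_mul_log_eq`), obtained NOT by Möbius inversion but by comparing the two
  closed forms of `S_q = Σ_{(a,q)=1} ψ(a/q)` in the tree (Murty–Rath's
  `DigammaRational.sum_coprime_digamma_div_eq` and `DiamondFord.sum_coprime_digamma_eq`).
* **Murty–Rath's Theorem 22.7 with the Möbius sum evaluated**: for `(a,q) = 1`,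
  `−ψ(a/q) = γ + log q + Σ_{p∣q} log p/(p−1) + (q/φ(q)) Σ_{χ≠χ₀} χ̄(a) L(1,χ)`
  (`neg_digamma_eq_log_add_sum_LFunction`).
* **The Euler–Lehmer constants through `L(1,χ)`** (Lehmer 1975; Gun–Saha–Sinha 2014, Theorem 4 at
  `Ω = ∅`: «`γ(Ω,a,q) = (1/φ(q)) Σ_{χ≠χ₀} χ̄(a)L(1,χ) Π_{p∈Ω}(1 − χ(p)/p) + (δ_Ω/q)(γ + Σ_{p∣q} log p/(p−1) + Σ_{p∈Ω} log p/(p−1))`»):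
  `γ(a,q) = −(ψ(a/q) + log q)/q = (γ + Σ_{p∣q} log p/(p−1))/q + (1/φ(q)) Σ_{χ≠χ₀} χ̄(a) L(1,χ)`
  (`eulerLehmer_eq_sum_LFunction`).

Cell pub-zeta5 (HONEST FRAMING: systematic search; no irrationality claim unless certified):
printed identities made kernel theorems; nothing here concerns `ζ(5)`.
-/

noncomputable section

open Complex Finset Filter Topology
open scoped ArithmeticFunction.Moebius

namespace Literature.NumberTheory.LFunctions

namespace DiamondFord

/-- **`Σ_{d∣q} μ(d)(q/d) log(q/d) = φ(q)·(log q + Σ_{p∣q} log p/(p−1))`** (`q ≥ 1`): the two closed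
forms of `Σ_{(a,q)=1} ψ(a/q)` — Möbius (Murty–Rath p. 127) and Euler-product (Diamond–Ford
Proposition 1) — compared. [cite: DiamondFord2008, §1 (display before Proposition 1)] -/
theorem sum_moebius_mul_div_mul_log_div_eq (q : ℕ) [NeZero q] :
    ∑ d ∈ q.divisors, (μ d : ℂ) * ((q / d : ℕ) : ℂ) * Real.log ((q / d : ℕ) : ℝ) =
      (q.totient : ℂ) * (Real.log q + ∑ p ∈ q.primeFactors, Complex.log p / ((p : ℂ) - 1)) := by
  have h1 := Literature.NumberTheory.LFunctions.DigammaRational.sum_coprime_digamma_div_eq (NeZero.ne q)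
  have h2 := sum_coprime_digamma_eq (N := q)
  rw [h2] at h1
  linear_combination h1

/-- **`Σ_{d∣q} μ(d)(q/d) log d = −φ(q) Σ_{p∣q} log p/(p−1)`** — Diamond–Ford's
«`−Σ_{d∣P} μ(d) log d/d = δ_P Σ_{p∈P} log p/(p−1)`» multiplied by `P` (and valid for every `q ≥ 1`,
`μ` killing the non-squarefree divisors). [cite: DiamondFord2008, §1 (display before Proposition 1)] -/
theorem sum_moebius_mul_div_mul_log_eq (q : ℕ) [NeZero q] :
    ∑ d ∈ q.divisors, (μ d : ℂ) * ((q / d : ℕ) : ℂ) * Real.log d =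
      -(q.totient : ℂ) * ∑ p ∈ q.primeFactors, Complex.log p / ((p : ℂ) - 1) := by
  have hq0 : q ≠ 0 := NeZero.ne q
  have h := sum_moebius_mul_div_mul_log_div_eq q
  -- `log(q/d) = log q − log d` for `d ∣ q`
  have hsplit : ∑ d ∈ q.divisors, (μ d : ℂ) * ((q / d : ℕ) : ℂ) * Real.log ((q / d : ℕ) : ℝ) =
      (∑ d ∈ q.divisors, (μ d : ℂ) * ((q / d : ℕ) : ℂ)) * Real.log q -
        ∑ d ∈ q.divisors, (μ d : ℂ) * ((q / d : ℕ) : ℂ) * Real.log d := by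
    rw [Finset.sum_mul, ← Finset.sum_sub_distrib]
    refine Finset.sum_congr rfl fun d hd => ?_
    have hdq : d ∣ q := Nat.dvd_of_mem_divisors hd
    have hd0 : 0 < d := Nat.pos_of_mem_divisors hd
    have hqd : 0 < q / d := Nat.div_pos (Nat.le_of_dvd (Nat.pos_of_ne_zero hq0) hdq) hd0
    rw [Nat.cast_div hdq (by exact_mod_cast hd0.ne' : (d : ℝ) ≠ 0),
      Real.log_div (by exact_mod_cast hq0) (by exact_mod_cast hd0.ne')]
    push_cast
    ring
  -- `Σ_{d∣q} μ(d)(q/d) = φ(q)`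
  have hphi : ∑ d ∈ q.divisors, (μ d : ℂ) * ((q / d : ℕ) : ℂ) = (q.totient : ℂ) := by
    have h := (ArithmeticFunction.sum_eq_iff_sum_mul_moebius_eq (R := ℂ) (f := fun n => (n.totient : ℂ))
      (g := fun n => (n : ℂ))).mp (fun n _ => by exact_mod_cast Nat.sum_totient n) q (Nat.pos_of_ne_zero hq0)
    rw [Nat.sum_divisorsAntidiagonal (fun d e => (μ d : ℂ) * (e : ℂ))] at h
    simpa using h
  rw [hsplit, hphi] at h
  linear_combination -h

/-- **Theorem 22.7 with the Möbius sum evaluated**: for `q ≥ 1`, `1 ≤ a ≤ q`, `(a,q) = 1`,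
`−ψ(a/q) = γ + log q + Σ_{p∣q} log p/(p−1) + (q/φ(q)) Σ_{χ≠χ₀} χ̄(a) L(1,χ)` (`χ̄(a)` typed `χ(a⁻¹)`).
[cite: MurtyRath2014, Ch. 22, Theorem 22.7 (p. 127, the re-written form)] -/
theorem neg_digamma_eq_log_add_sum_LFunction {q : ℕ} [NeZero q] {a : ℕ} (ha : a ∈ Icc 1 q)
    (hcop : a.Coprime q) :
    -Complex.digamma ((a : ℂ) / q) =
      Real.eulerMascheroniConstant + Real.log q + ∑ p ∈ q.primeFactors, Complex.log p / ((p : ℂ) - 1) +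
        (q : ℂ) / q.totient * ∑ χ ∈ (univ : Finset (DirichletCharacter ℂ q)).erase 1,
          χ ((a : ZMod q)⁻¹) * χ.LFunction 1 := by
  have hq0 : q ≠ 0 := NeZero.ne q
  have hq : (q : ℂ) ≠ 0 := by exact_mod_cast hq0
  have hφ : (q.totient : ℂ) ≠ 0 := by exact_mod_cast (Nat.totient_pos.mpr (Nat.pos_of_ne_zero hq0)).ne'
  have h := Literature.NumberTheory.LFunctions.DigammaRational.neg_digamma_div_eq ha hcop
  -- the Möbius sum, in the `μ(d)/d · log(q/d)` normalisation of Theorem 22.7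
  have hM : (q : ℂ) / q.totient * ∑ d ∈ q.divisors, (μ d : ℂ) / d * Real.log ((q / d : ℕ) : ℝ) =
      Real.log q + ∑ p ∈ q.primeFactors, Complex.log p / ((p : ℂ) - 1) := by
    have hsum : ∑ d ∈ q.divisors, (μ d : ℂ) * ((q / d : ℕ) : ℂ) * Real.log ((q / d : ℕ) : ℝ) =
        (q : ℂ) * ∑ d ∈ q.divisors, (μ d : ℂ) / d * Real.log ((q / d : ℕ) : ℝ) := by
      rw [Finset.mul_sum]
      refine Finset.sum_congr rfl fun d hd => ?_
      have hdq : d ∣ q := Nat.dvd_of_mem_divisors hd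
      have hd0 : (d : ℂ) ≠ 0 := by exact_mod_cast (Nat.pos_of_mem_divisors hd).ne'
      rw [Nat.cast_div hdq hd0]
      field_simp
    have h1 := sum_moebius_mul_div_mul_log_div_eq q
    rw [hsum] at h1
    rw [div_mul_eq_mul_div, h1]
    field_simp
  rw [h, hM]
  ring

/-- **The Euler–Lehmer constants through `L(1,χ)`** (Lehmer 1975; Gun–Saha–Sinha 2014, Theorem 4 at
`Ω = ∅`): for `q ≥ 1`, `1 ≤ a ≤ q`, `(a,q) = 1`,
`γ(a,q) = −(ψ(a/q) + log q)/q = (γ + Σ_{p∣q} log p/(p−1))/q + (1/φ(q)) Σ_{χ≠χ₀} χ̄(a) L(1,χ)`.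
[cite: GunSahaSinha2014, Theorem 4 (Ω = ∅; via Gun–Murty–Saha arXiv:1604.02896 §1 Theorem 4)] -/
theorem eulerLehmer_eq_sum_LFunction {q : ℕ} [NeZero q] {a : ℕ} (ha : a ∈ Icc 1 q)
    (hcop : a.Coprime q) :
    -(Complex.digamma ((a : ℂ) / q) + Real.log q) / q =
      (Real.eulerMascheroniConstant + ∑ p ∈ q.primeFactors, Complex.log p / ((p : ℂ) - 1)) / q +
        (q.totient : ℂ)⁻¹ * ∑ χ ∈ (univ : Finset (DirichletCharacter ℂ q)).erase 1,
          χ ((a : ZMod q)⁻¹) * χ.LFunction 1 := by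
  have hq : (q : ℂ) ≠ 0 := by exact_mod_cast NeZero.ne q
  have hφ : (q.totient : ℂ) ≠ 0 := by
    exact_mod_cast (Nat.totient_pos.mpr (Nat.pos_of_ne_zero (NeZero.ne q))).ne'
  have h := neg_digamma_eq_log_add_sum_LFunction ha hcop
  rw [show -(Complex.digamma ((a : ℂ) / q) + Real.log q) = -Complex.digamma ((a : ℂ) / q) - Real.log q by ring,
    h]
  field_simp
  ring

end DiamondFord

end Literature.NumberTheory.LFunctions
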